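import Literature.NumberTheory.EllipticCurves.WeierstrassTransformationOdd
import Literature.NumberTheory.EllipticCurves.WeierstrassCMElevenCertificate
import HarnessLib

/-!
# Complex multiplication of norm eleven: `j((1 + √−43)/2) = −884736000 = −960³`

Topic `NumberTheory/EllipticCurves`; dot-notation extensions of Mathlib's `PeriodPair`, continuing
`WeierstrassTransformation.lean` (norms `2, 3`), `WeierstrassTransformationFive.lean` (norm `5`)
and `WeierstrassTransformationOdd.lean` (the Laurent-matching equations in any odd norm).
Everything here is **proved**.

* `PeriodPair.j_eq_of_cmEleven_of_sq_eq_self_sub_eleven` : if `α² = α − 11` and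
  `α⁻¹Λ = ⋃_{|k| ≤ 5} (kw + Λ)` with `kw ∉ Λ` for `0 < |k| ≤ 10` (so `αΛ ⊂ Λ` has index `11`), then
  `j(Λ) = −884736000 = (−960)³` — the value `j((1 + √−43)/2)` of Cox's table (12.20)
  (*Primes of the form x² + ny²*, §12.C), row `d_K = −43`, obtained by the method of §10.C
  ((10.21)–(10.22): comparison of the Laurent expansions of `℘(αz)` and `℘(z)`) for the CM element
  `(1 + √−43)/2` of norm `11`.

The argument: the coefficients of `z², z⁴, …, z¹⁴` at `0` of
`℘_{α⁻¹Λ}(z) − ℘_Λ(z) = Σ_{0<|k|≤5} (℘_Λ(z − kw) − ℘_Λ(kw))` (`PeriodPair.cmOdd_taylor_even`, with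
`G_{2m+2}(α⁻¹Λ) = α^{2m+2}G_{2m+2}(Λ)`, `℘⁽²ᵐ⁾ = P_m(℘)` for `m ≤ 7` and `G₈, …, G₁₆ ∈ ℚ[G₄, G₆]`
from `WeierstrassLaurent.lean`) are seven polynomial equations in `α, G₄, G₆` and the power sums
`p_i` of `℘(w), …, ℘(5w)`; `PeriodPair.CMEleven.elim` eliminates `p₂, …, p₈` (Newton's identities
for five quantities enter for `p₆, p₇, p₈`), and the Macaulay2 certificates
`PeriodPair.CMEleven.cert` / `cert_degen` (`WeierstrassCMElevenCertificate.lean`) give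
`G₄⁴(25600G₆² − 10449G₄³) = 0` and `G₄ = 0 ⇒ G₆ = 0`; as `Δ = g₂³ − 27g₃² ≠ 0`, `G₄ ≠ 0`, so
`25600G₆² = 10449G₄³` and `j = 1728g₂³/Δ = −884736000`.

Why here: row `d_K = −43` of the named fact `Literature.NumberTheory.EllipticCurves.singularModuli_classNumberOne` (level 4 of
the decomposition of `Literature.NumberTheory.EllipticCurves.finite_point_of_j_mem_maximalCMJInvariants_of_L_one_ne_zero`), see
`ComplexMultiplicationSingularModuliRowFortyThree.lean`.

## References

* D. A. Cox, *Primes of the form x² + ny²*, 2nd ed., Wiley 2013: §10.C eqs. (10.21)–(10.22)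
  (PDF pp. 223–224); §12.C table (12.20) (PDF pp. 266–267).
-/

noncomputable section

open scoped Topology
open Filter Set Complex

namespace PeriodPair

section CMEleven

variable {L : PeriodPair} {α w : ℂ}

/-- `Σ_{i<5} g(i) = g 0 + ⋯ + g 4`, with the casts `((i+1 : ℕ) : ℂ)` evaluated. [folklore] -/
private lemma sum_range_five_weierstrassP (P : ℂ → ℂ) (w : ℂ) :
    ∑ i ∈ Finset.range 5, P (℘[L] ((i + 1 : ℕ) * w)) =
      P (℘[L] w) + P (℘[L] (2 * w)) + P (℘[L] (3 * w)) + P (℘[L] (4 * w)) + P (℘[L] (5 * w)) := by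
  simp only [Finset.sum_range_succ, Finset.sum_range_zero, Nat.reduceAdd, Nat.cast_one,
    Nat.cast_ofNat, one_mul, zero_add]

/-- **`j = −884736000 = (−960)³` for a lattice with complex multiplication by `(1 + √−43)/2`.**
If `α² = α − 11`, `α⁻¹Λ = ⋃_{|k| ≤ 5} (kw + Λ)` (i.e. `αx ∈ Λ ↔ ∃ k, |k| ≤ 5, x − kw ∈ Λ`) and
`kw ∉ Λ` for `0 < |k| ≤ 10`, then `25600G₆(Λ)² = 10449G₄(Λ)³`, whence `j(Λ) = −884736000` — the
value `j((1 + √−43)/2) = −960³` of Cox's table (12.20), obtained here by the method of §10.C for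
an element of norm `11`: the coefficients of `z², …, z¹⁴` of the Laurent expansions at `0` of the
two sides of the transformation formula `℘_{α⁻¹Λ}(z) = Σ_{|k|≤5} ℘(z − kw) − Σ_{0<|k|≤5} ℘(kw)`
(`PeriodPair.cmOdd_taylor_even` with `℘⁽²ᵐ⁾ = P_m(℘)`, `m ≤ 7`, and `G₈, …, G₁₆` from
`WeierstrassLaurent.lean`) give seven polynomial equations in `α`, `G₄`, `G₆` and the power sums
of `℘(w), …, ℘(5w)`, from which `p₂, …, p₈` are eliminated (`PeriodPair.CMEleven.elim`) and the
conclusion follows by an explicit ideal-membership certificate (`PeriodPair.CMEleven.cert`,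
`PeriodPair.CMEleven.cert_degen`, the latter excluding `G₄ = 0` via `Δ ≠ 0`).
[cite: Cox2013, §12.C table (12.20) row d_K = -43 (method of §10.C (10.21)–(10.22))] -/
theorem j_eq_of_cmEleven_of_sq_eq_self_sub_eleven (hα2 : α ^ 2 = α - 11)
    (hΛ : ∀ x, α * x ∈ L.lattice ↔ ∃ k : ℤ, -5 ≤ k ∧ k ≤ 5 ∧ x - k * w ∈ L.lattice)
    (hsmall : ∀ k : ℤ, k ≠ 0 → -10 ≤ k → k ≤ 10 → (k : ℂ) * w ∉ L.lattice) :
    L.j = -884736000 := by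
  have hα : α ≠ 0 := by rintro rfl; norm_num at hα2
  have hΛ5 : ∀ x, α * x ∈ L.lattice ↔
      ∃ k : ℤ, -((5 : ℕ) : ℤ) ≤ k ∧ k ≤ (5 : ℕ) ∧ x - k * w ∈ L.lattice := by
    simpa using hΛ
  have hsmall5 : ∀ k : ℤ, k ≠ 0 → -(2 * (5 : ℕ) : ℤ) ≤ k → k ≤ 2 * (5 : ℕ) →
      (k : ℂ) * w ∉ L.lattice := fun k hk h1 h2 ↦ hsmall k hk (by omega) (by omega)
  have hT : ∀ z, z ∉ (L.mulLeft α⁻¹ (inv_ne_zero hα)).lattice →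
      ℘[L.mulLeft α⁻¹ (inv_ne_zero hα)] z =
        ∑ c ∈ repsOdd w 5, ℘[L] (z - c) - ∑ c ∈ (repsOdd w 5).erase 0, ℘[L] c :=
    fun z hz ↦ cmOdd_transformation hα hΛ5 hsmall5 hz
  -- the seven Laurent-matching equations
  have T1 := cmOdd_taylor_even hα (by norm_num) hsmall5 hT (n := 2) (by norm_num)
    fun z hz ↦ L.iteratedDeriv_2_weierstrassP_eq hz
  have T2 := cmOdd_taylor_even hα (by norm_num) hsmall5 hT (n := 4) (by norm_num)
    fun z hz ↦ L.iteratedDeriv_4_weierstrassP_eq hz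
  have T3 := cmOdd_taylor_even hα (by norm_num) hsmall5 hT (n := 6) (by norm_num)
    fun z hz ↦ L.iteratedDeriv_6_weierstrassP_eq hz
  have T4 := cmOdd_taylor_even hα (by norm_num) hsmall5 hT (n := 8) (by norm_num)
    fun z hz ↦ L.iteratedDeriv_8_weierstrassP_eq hz
  have T5 := cmOdd_taylor_even hα (by norm_num) hsmall5 hT (n := 10) (by norm_num)
    fun z hz ↦ L.iteratedDeriv_10_weierstrassP_eq hz
  have T6 := cmOdd_taylor_even hα (by norm_num) hsmall5 hT (n := 12) (by norm_num)
    fun z hz ↦ L.iteratedDeriv_12_weierstrassP_eq hz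
  have T7 := cmOdd_taylor_even hα (by norm_num) hsmall5 hT (n := 14) (by norm_num)
    fun z hz ↦ L.iteratedDeriv_14_weierstrassP_eq hz
  rw [sum_range_five_weierstrassP] at T1 T2 T3 T4 T5 T6 T7
  simp only [Nat.reduceAdd, Nat.factorial, Nat.succ_eq_add_one, Nat.reduceMul, Nat.cast_ofNat,
    P1, P2, P3, P4, P5, P6, P7, polyFun, pc1, pc2, pc3, pc4, pc5, pc6, pc7,
    Finset.sum_range_succ, Finset.sum_range_zero, g₂, g₃] at T1 T2 T3 T4 T5 T6 T7
  rw [L.G_eight] at T3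
  rw [L.G_ten] at T4
  rw [L.G_twelve] at T5
  rw [L.G_fourteen] at T6
  rw [L.G_sixteen] at T7
  set e₁ := ℘[L] w
  set e₂ := ℘[L] (2 * w)
  set e₃ := ℘[L] (3 * w)
  set e₄ := ℘[L] (4 * w)
  set e₅ := ℘[L] (5 * w)
  obtain ⟨h5, h6, h7⟩ := CMEleven.elim (α := α) (G₄ := L.G 4) (G₆ := L.G 6)
    (p₁ := e₁ + e₂ + e₃ + e₄ + e₅)
    (p₂ := e₁ ^ 2 + e₂ ^ 2 + e₃ ^ 2 + e₄ ^ 2 + e₅ ^ 2)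
    (p₃ := e₁ ^ 3 + e₂ ^ 3 + e₃ ^ 3 + e₄ ^ 3 + e₅ ^ 3)
    (p₄ := e₁ ^ 4 + e₂ ^ 4 + e₃ ^ 4 + e₄ ^ 4 + e₅ ^ 4)
    (p₅ := e₁ ^ 5 + e₂ ^ 5 + e₃ ^ 5 + e₄ ^ 5 + e₅ ^ 5)
    (p₆ := e₁ ^ 6 + e₂ ^ 6 + e₃ ^ 6 + e₄ ^ 6 + e₅ ^ 6)
    (p₇ := e₁ ^ 7 + e₂ ^ 7 + e₃ ^ 7 + e₄ ^ 7 + e₅ ^ 7)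
    (p₈ := e₁ ^ 8 + e₂ ^ 8 + e₃ ^ 8 + e₄ ^ 8 + e₅ ^ 8)
    hα2 (by linear_combination T1) (by linear_combination T2) (by linear_combination T3)
    (by linear_combination T4) (by linear_combination T5) (by linear_combination T6)
    (by linear_combination T7) (by ring) (by ring) (by ring)
  have key := CMEleven.cert hα2 h5 h6 h7
  have hG4 : L.G 4 ≠ 0 := by
    intro hG4
    have h3 := CMEleven.cert_degen hα2 h5 h6 h7 hG4
    have hG6 : L.G 6 = 0 := pow_eq_zero_iff (n := 3) (by norm_num) |>.mp h3
    exact L.discr_ne_zero (by simp [g₂, g₃, hG4, hG6])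
  have T : 25600 * L.G 6 ^ 2 - 10449 * L.G 4 ^ 3 = 0 :=
    (mul_eq_zero.mp key).resolve_left (pow_ne_zero 4 hG4)
  rw [j_def, div_eq_iff L.discr_ne_zero]
  simp only [g₂, g₃]
  linear_combination (-18289152000) * T

end CMEleven

end PeriodPair

end
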